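/-
Copyright (c) 2026 the pub-hodgecm-mathlib formalisation cell (harness21).  Prover seat hodgecm-mathlib-F0P3a-p07 (g13), 2026-09-01.  Road «S3-ram» seeding wave (LEAD T11-41∕T11-60; owner F0P3a-p06 (g15));
(α₂) organ A₂ (d-i) «TYPE-(2) ROOT REGION»: the BLOCK twin of ★ p847183 (F0P3a-p01 (g16)) — a line eigenvector isolated from a 2-block by a Cayley–Hamilton unit.
-/
import Literature.NumberTheory.Automorphic.UnitaryLatticeTreeIsolatedIndexStableRoot   -- ★ p847183 (F0P3a-p01 (g16)): the DIAGONAL model (imports ★ p847156, ★ `dualLatt_eq_self_of_isSelfDualLattice`)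
import HarnessLib

/-!
# The lattice graph of a hermitian space — an endomorphism with an ISOLATED LINE (block `S = S_W ⊕ s`, `χ_{S_W}(s)` a unit) splits every stable self-dual lattice as
# `𝒪e_i ⊕ (binary part)` (Bruhat–Tits 1972 §10; Kottwitz 1986 §3; Serre, *Trees* II.1.1)

Topic `NumberTheory/Automorphic`; namespace `Literature.NumberTheory.Automorphic.UnitaryLatticeTree`.  THEOREMS ONLY (no definition, no instance, no notation, no named fact,
no `sorry`); kernel lane `--supports stmt-HodgeConjecture-24833`; datum-free (`K` with `Valued K ℤᵐ⁰`, `σ` valuation-preserving).  Cell `pub/hodgecm-mathlib`, crux H413 =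
`stmt-HodgeConjecture-24833`; road «S3-ram» (count-neutral), (α₂) P-2-ram skeleton (architect A-p12 (g23)) organ A₂ (d) «type-(2) fixed-lattice strata counts», part (d-i)
THE ROOT REGION: the BLOCK twin of ★ `UnitaryLatticeTreeIsolatedIndexStableRoot` (p847183, F0P3a-p01 (g16): DIAGONAL `S` with one isolated residue).  Seat F0P3a-p07 (g13).
HONEST LABEL: HC_CM is proved only modulo the cell's 2 remaining named inputs (hLiu418 24832, h413 24833) until rung 0 closes; nothing printed is asserted here (elementary
lattice algebra over a valuation ring).

THE MATHEMATICS.  A type-(2) element near `1` is, in an adapted integral frame, `γ = γ_W ⊕ u` on `V = W ⊕ Ke_i` with `γ_W` ELLIPTIC on the plane `W = {x : x_i = 0}` (irreducible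
characteristic polynomial) and `u` a scalar on the line; the top-level endomorphism `S = π^{−d}(γ − 1)` is then BLOCK: `S e_i = s·e_i` (`s = S_{ii}`), `S(W) ⊆ W`, all entries integral,
and `S|_W` is killed by an integral monic quadratic `p(T) = T² + bT + c` (Cayley–Hamilton) whose value `p(s)` at the line's eigenvalue is a UNIT — automatically so when `S̄|_W` is
residually irreducible, since `p̄` then has no root in the residue field.  This file proves, for such `(S, i, b, c)` (no diagonalisability of `S|_W` needed):
(§1) an `S`-stable `𝒪`-submodule `M ⊆ K³` is COORDINATE-CLOSED AT `i`: `x ∈ M ⇒ x_i e_i ∈ M` — the idempotent `E = p(S)∕p(s)` is an INTEGRAL polynomial in `S`, kills `W`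
and fixes `e_i`, so `E x = x_i e_i`; (§2) if `M` is moreover SELF-DUAL for a form `H` that is BLOCK at `i` (`H_{li} = H_{il} = 0` for `l ≠ i`, `|H_{ii}| = 1`, `det H ≠ 0`), then
`|x_i| ≤ 1` on `M` and `e_i ∈ M`; (§3) hence `M = 𝒪e_i ⊕ (M ∩ W)`; (§4) and `M ∩ W` is self-dual RELATIVE to `W`: for `w ∈ W`, `w ∈ M ⟺ ∀ m ∈ M ∩ W, |⟨m, w⟩_H| ≤ 1`.
So the type-(2) ROOT REGION (fixed self-dual rank-3 lattices at the top level) is in bijection with the `S|_W`-stable self-dual BINARY lattices of `(W, H|_W)` — the binary fixed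
ball of the elliptic `γ_W` (A-p12 (g23)'s ★ `UnitaryTwoRamifiedEllipticFixedModularVertices` ∕ ★ `SLTwoTreeRamifiedEllipticFixedBall` counts), exactly as ★ p847183 reduces the
isoceles type-(1) root region to a binary fixed ball.
* §1 `mulVec_single_of_col_eq`, `mulVec_apply_eq_zero_of_row_eq`, `single_apply_mem_of_map_le_of_block`, `sub_single_apply_mem_of_map_le_of_block`;
* §2 `pairing_single_left_of_block`, `pairing_single_right_of_block`, `v_apply_le_one_and_single_mem_of_block`;
* §3 `mem_iff_v_apply_le_one_and_sub_single_mem_of_block`; §4 `mem_iff_forall_pairing_le_one_of_block`.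

## References
* [BruhatTits1972] F. Bruhat, J. Tits, *Groupes réductifs sur un corps local I*, Publ. Math. IHÉS 41 (1972), §10 (lattices adapted to a partial eigen-decomposition).
* [Kottwitz1986] R. E. Kottwitz, *Base change for unit elements of Hecke algebras*, Compositio Math. 60 (1986), §3 (fixed lattices as `𝒪[γ]`-modules; reduction to Levi blocks).
* [Serre1980Trees] J.-P. Serre, *Trees* (1980), Ch. II §1.1.
-/

set_option autoImplicit false

noncomputable section

open scoped Valued WithZero Matrix MatrixGroups

namespace Literature.NumberTheory.Automorphic.UnitaryLatticeTree

open Literature.NumberTheory.Automorphic Literature.NumberTheory.Automorphic.HermitianLattice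

variable {K : Type*} [Field K] [Valued K ℤᵐ⁰]

/-! ## §1 An isolated line ⇒ coordinate closure at that index -/

omit [Valued K ℤᵐ⁰] in
/-- If the `i`-th COLUMN of `S` is `s·e_i` then `S·(a e_i) = (S_{ii} a)·e_i`. [cite: BruhatTits1972, §10] -/
theorem mulVec_single_of_col_eq {N : ℕ} (S : Matrix (Fin N) (Fin N) K) (i : Fin N) (hcol : ∀ l, l ≠ i → S l i = 0) (a : K) :
    S *ᵥ Pi.single i a = Pi.single i (S i i * a) := by
  ext l
  rw [Matrix.mulVec, dotProduct, Finset.sum_eq_single i]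
  · by_cases hl : l = i
    · subst hl; rw [Pi.single_eq_same, Pi.single_eq_same]
    · rw [Pi.single_eq_same, Pi.single_eq_of_ne hl, hcol l hl, zero_mul]
  · intro j _ hj; rw [Pi.single_eq_of_ne hj, mul_zero]
  · intro hi; exact absurd (Finset.mem_univ i) hi

omit [Valued K ℤᵐ⁰] in
/-- If the `i`-th ROW of `S` vanishes off the diagonal then `S` preserves the hyperplane `W_i = {x : x_i = 0}`: `(S w)_i = 0` for `w_i = 0`. [cite: BruhatTits1972, §10] -/
theorem mulVec_apply_eq_zero_of_row_eq {N : ℕ} (S : Matrix (Fin N) (Fin N) K) (i : Fin N) (hrow : ∀ l, l ≠ i → S i l = 0) {w : Fin N → K} (hwi : w i = 0) :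
    (S *ᵥ w) i = 0 := by
  rw [Matrix.mulVec, dotProduct]
  refine Finset.sum_eq_zero fun l _ => ?_
  by_cases hl : l = i
  · subst hl; rw [hwi, mul_zero]
  · rw [hrow l hl, zero_mul]

/-- **COORDINATE CLOSURE AT AN ISOLATED LINE** (`N = 3`): `S` with `S e_i = S_{ii} e_i` (column `i`), `W_i = {x_i = 0}` killed by the integral quadratic `p(S)`, `p(T)`
`T² + bT + c` whose value at `S_{ii}` is a unit; if `M` is `S`-stable then `x_i e_i ∈ M` for every `x ∈ M` — the idempotent `(S² + bS + c)∕(S_{ii}² + bS_{ii} + c)` is integral in `S`,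
kills `W_i`, fixes `e_i`. [cite: Kottwitz1986, §3] [cite: BruhatTits1972, §10] -/
theorem single_apply_mem_of_map_le_of_block {S : Matrix (Fin 3) (Fin 3) K} (i : Fin 3)
    (hcol : ∀ l, l ≠ i → S l i = 0)
    {b c : K} (hb : Valued.v b ≤ 1) (hc : Valued.v c ≤ 1)
    (hann : ∀ w : Fin 3 → K, w i = 0 → S *ᵥ (S *ᵥ w) + b • (S *ᵥ w) + c • w = 0)
    (hunit : Valued.v (S i i * S i i + b * S i i + c) = 1)
    {M : Submodule 𝒪[K] (Fin 3 → K)} (hSM : M.map ((Matrix.toLin' S).restrictScalars 𝒪[K]) ≤ M)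
    {x : Fin 3 → K} (hx : x ∈ M) : Pi.single i (x i) ∈ M := by
  -- `S·M ⊆ M`
  have hSx : ∀ y ∈ M, S *ᵥ y ∈ M := fun y hy => by
    have h := hSM (Submodule.mem_map.2 ⟨y, hy, rfl⟩)
    rwa [LinearMap.restrictScalars_apply, Matrix.toLin'_apply] at h
  -- `p(S)·x = p(S_{ii})·x_i·e_i`: split `x = x_i e_i + w`, `w ∈ W_i`
  have hwi : (x - Pi.single i (x i) : Fin 3 → K) i = 0 := by simp
  have hw0 := hann (x - Pi.single i (x i)) hwi
  have hpx : S *ᵥ (S *ᵥ x) + b • (S *ᵥ x) + c • x = Pi.single i ((S i i * S i i + b * S i i + c) * x i) := by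
    have hx' : x = Pi.single i (x i) + (x - Pi.single i (x i)) := (add_sub_cancel _ _).symm
    have hS1 : S *ᵥ x = Pi.single i (S i i * x i) + S *ᵥ (x - Pi.single i (x i)) := by
      conv_lhs => rw [hx']
      rw [Matrix.mulVec_add, mulVec_single_of_col_eq S i hcol]
    have hS2 : S *ᵥ (S *ᵥ x) = Pi.single i (S i i * (S i i * x i)) + S *ᵥ (S *ᵥ (x - Pi.single i (x i))) := by
      rw [hS1, Matrix.mulVec_add, mulVec_single_of_col_eq S i hcol]
    have hcx : c • x = Pi.single i (c * x i) + c • (x - Pi.single i (x i)) := by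
      conv_lhs => rw [hx']
      rw [smul_add, ← Pi.single_smul', smul_eq_mul]
    rw [hS2, hS1, smul_add, ← Pi.single_smul', smul_eq_mul, hcx]
    have hre : Pi.single i (S i i * (S i i * x i)) + S *ᵥ (S *ᵥ (x - Pi.single i (x i))) +
          (Pi.single i (b * (S i i * x i)) + b • (S *ᵥ (x - Pi.single i (x i)))) + (Pi.single i (c * x i) + c • (x - Pi.single i (x i))) =
        (Pi.single i (S i i * (S i i * x i)) + Pi.single i (b * (S i i * x i)) + Pi.single i (c * x i)) +
          (S *ᵥ (S *ᵥ (x - Pi.single i (x i))) + b • (S *ᵥ (x - Pi.single i (x i))) + c • (x - Pi.single i (x i))) := by abel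
    rw [hre, hw0, add_zero, ← Pi.single_add, ← Pi.single_add]
    congr 1
    ring
  -- `p(S)·x ∈ M`
  have hmem : S *ᵥ (S *ᵥ x) + b • (S *ᵥ x) + c • x ∈ M := by
    refine M.add_mem (M.add_mem (hSx _ (hSx _ hx)) ?_) ?_
    · exact M.smul_mem (⟨b, (mem_integer_iff' _).2 hb⟩ : 𝒪[K]) (hSx _ hx)
    · exact M.smul_mem (⟨c, (mem_integer_iff' _).2 hc⟩ : 𝒪[K]) hx
  rw [hpx] at hmem
  -- divide by the unit `p(S_{ii})`
  have hne : S i i * S i i + b * S i i + c ≠ 0 := fun h0 => by rw [h0, map_zero] at hunit; exact zero_ne_one hunit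
  have hinv : Valued.v (S i i * S i i + b * S i i + c)⁻¹ ≤ 1 := by rw [map_inv₀, hunit, inv_one]
  have h := M.smul_mem (⟨(S i i * S i i + b * S i i + c)⁻¹, (mem_integer_iff' _).2 hinv⟩ : 𝒪[K]) hmem
  have hval : ((⟨(S i i * S i i + b * S i i + c)⁻¹, (mem_integer_iff' _).2 hinv⟩ : 𝒪[K]) • Pi.single i ((S i i * S i i + b * S i i + c) * x i) : Fin 3 → K) =
      Pi.single i (x i) := by
    change (S i i * S i i + b * S i i + c)⁻¹ • Pi.single i ((S i i * S i i + b * S i i + c) * x i) = Pi.single i (x i)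
    rw [← Pi.single_smul', smul_eq_mul, ← mul_assoc, inv_mul_cancel₀ hne, one_mul]
  rwa [hval] at h

/-- … and the complementary projection `x − x_i e_i ∈ M ∩ W_i`. [cite: Kottwitz1986, §3] -/
theorem sub_single_apply_mem_of_map_le_of_block {S : Matrix (Fin 3) (Fin 3) K} (i : Fin 3)
    (hcol : ∀ l, l ≠ i → S l i = 0)
    {b c : K} (hb : Valued.v b ≤ 1) (hc : Valued.v c ≤ 1)
    (hann : ∀ w : Fin 3 → K, w i = 0 → S *ᵥ (S *ᵥ w) + b • (S *ᵥ w) + c • w = 0)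
    (hunit : Valued.v (S i i * S i i + b * S i i + c) = 1)
    {M : Submodule 𝒪[K] (Fin 3 → K)} (hSM : M.map ((Matrix.toLin' S).restrictScalars 𝒪[K]) ≤ M)
    {x : Fin 3 → K} (hx : x ∈ M) : x - Pi.single i (x i) ∈ M ∧ (x - Pi.single i (x i) : Fin 3 → K) i = 0 :=
  ⟨M.sub_mem hx (single_apply_mem_of_map_le_of_block i hcol hb hc hann hunit hSM hx), by simp⟩

/-! ## §2 Self-duality for a BLOCK form pins the `e_i`-component to `𝒪e_i` -/

omit [Valued K ℤᵐ⁰] in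
/-- The pairing of a form BLOCK at `i` (row `i` of `H` vanishes off the diagonal) against a coordinate vector on the left: `⟨c·e_i, w⟩_H = σ(c)·H_{ii}·w_i`.
[cite: BruhatTits1972, §10] -/
theorem pairing_single_left_of_block {N : ℕ} (σ : K →+* K) (H : Matrix (Fin N) (Fin N) K) (i : Fin N) (hHrow : ∀ l, l ≠ i → H i l = 0) (c : K) (w : Fin N → K) :
    pairing σ H (Pi.single i c) w = σ c * H i i * w i := by
  rw [pairing_apply, Finset.sum_eq_single i]
  · rw [Finset.sum_eq_single i, Pi.single_eq_same]
    · intro j _ hj; rw [hHrow j hj, mul_zero, zero_mul]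
    · intro hi; exact absurd (Finset.mem_univ i) hi
  · intro j _ hj; rw [Pi.single_eq_of_ne hj, map_zero]; simp
  · intro hi; exact absurd (Finset.mem_univ i) hi

omit [Valued K ℤᵐ⁰] in
/-- The pairing of a form BLOCK at `i` (column `i` of `H` vanishes off the diagonal) against a coordinate vector on the right: `⟨m, c·e_i⟩_H = σ(m_i)·H_{ii}·c`.
[cite: BruhatTits1972, §10] -/
theorem pairing_single_right_of_block {N : ℕ} (σ : K →+* K) (H : Matrix (Fin N) (Fin N) K) (i : Fin N) (hHcol : ∀ l, l ≠ i → H l i = 0) (m : Fin N → K) (c : K) :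
    pairing σ H m (Pi.single i c) = σ (m i) * H i i * c := by
  rw [pairing_apply, Finset.sum_eq_single i]
  · rw [Finset.sum_eq_single i, Pi.single_eq_same]
    · intro j _ hj; rw [Pi.single_eq_of_ne hj, mul_zero]
    · intro hi; exact absurd (Finset.mem_univ i) hi
  · intro l _ hl
    refine Finset.sum_eq_zero fun j _ => ?_
    by_cases hj : j = i
    · subst hj; rw [hHcol l hl, mul_zero, zero_mul]
    · rw [Pi.single_eq_of_ne hj, mul_zero]
  · intro hi; exact absurd (Finset.mem_univ i) hi

/-- For a self-dual `M` (form `H` BLOCK at `i` with `|H_{ii}| = 1`, `det H` a unit) stable under an integral block `S` with an isolated line at `i` (§1): every `x ∈ M` has `|x_i| ≤ 1`,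
and `e_i ∈ M`. [cite: Kottwitz1986, §3] [cite: BruhatTits1972, §10] -/
theorem v_apply_le_one_and_single_mem_of_block {σ : K →+* K} (hvσ : ∀ a, Valued.v (σ a) = Valued.v a) {ϖ : K} {H : Matrix (Fin 3) (Fin 3) K} (i : Fin 3)
    (hHcol : ∀ l, l ≠ i → H l i = 0) (hHrow : ∀ l, l ≠ i → H i l = 0) (hhi : Valued.v (H i i) = 1) (hHdet : IsUnit H.det)
    {S : Matrix (Fin 3) (Fin 3) K} (hcol : ∀ l, l ≠ i → S l i = 0)
    {b c : K} (hb : Valued.v b ≤ 1) (hc : Valued.v c ≤ 1)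
    (hann : ∀ w : Fin 3 → K, w i = 0 → S *ᵥ (S *ᵥ w) + b • (S *ᵥ w) + c • w = 0)
    (hunit : Valued.v (S i i * S i i + b * S i i + c) = 1)
    {M : Submodule 𝒪[K] (Fin 3 → K)} (hM : IsSelfDualLattice σ ϖ H M)
    (hSM : M.map ((Matrix.toLin' S).restrictScalars 𝒪[K]) ≤ M) :
    (∀ x ∈ M, Valued.v (x i) ≤ 1) ∧ (Pi.single i (1 : K) : Fin 3 → K) ∈ M := by
  have hMd : M ≤ dualLatt σ H M := le_dualLatt_of_isVertexLattice hvσ hM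
  -- `|x_i| ≤ 1`: pair `x_i e_i ∈ M` with itself
  have hcoord : ∀ x ∈ M, Valued.v (x i) ≤ 1 := by
    intro x hx
    have hy := single_apply_mem_of_map_le_of_block i hcol hb hc hann hunit hSM hx
    have hpair := (mem_dualLatt σ _ M _).1 (hMd hy) _ hy
    rw [pairing_single_left_of_block σ H i hHrow, Pi.single_eq_same, map_mul, map_mul, hvσ, hhi, mul_one] at hpair
    by_contra hgt
    rw [not_le] at hgt
    exact (not_le.2 (one_lt_mul'' hgt hgt)) hpair
  refine ⟨hcoord, ?_⟩
  -- `e_i ∈ M^♯ = M`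
  rw [← dualLatt_eq_self_of_isSelfDualLattice hvσ hHdet hM, mem_dualLatt]
  intro y hy
  rw [pairing_single_right_of_block σ H i hHcol, mul_one, map_mul, hvσ, hhi, mul_one]
  exact hcoord y hy

/-! ## §3 The splitting `M = 𝒪e_i ⊕ (M ∩ W_i)` -/

/-- **SPLITTING**: under the hypotheses of §2, `x ∈ M ↔ |x_i| ≤ 1 ∧ x − x_i e_i ∈ M` — the `e_i`-component of a root-region vertex is exactly `𝒪e_i` and the rest lies in
`M ∩ W_i`. [cite: Kottwitz1986, §3] [cite: BruhatTits1972, §10] -/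
theorem mem_iff_v_apply_le_one_and_sub_single_mem_of_block {σ : K →+* K} (hvσ : ∀ a, Valued.v (σ a) = Valued.v a) {ϖ : K} {H : Matrix (Fin 3) (Fin 3) K} (i : Fin 3)
    (hHcol : ∀ l, l ≠ i → H l i = 0) (hHrow : ∀ l, l ≠ i → H i l = 0) (hhi : Valued.v (H i i) = 1) (hHdet : IsUnit H.det)
    {S : Matrix (Fin 3) (Fin 3) K} (hcol : ∀ l, l ≠ i → S l i = 0)
    {b c : K} (hb : Valued.v b ≤ 1) (hc : Valued.v c ≤ 1)
    (hann : ∀ w : Fin 3 → K, w i = 0 → S *ᵥ (S *ᵥ w) + b • (S *ᵥ w) + c • w = 0)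
    (hunit : Valued.v (S i i * S i i + b * S i i + c) = 1)
    {M : Submodule 𝒪[K] (Fin 3 → K)} (hM : IsSelfDualLattice σ ϖ H M)
    (hSM : M.map ((Matrix.toLin' S).restrictScalars 𝒪[K]) ≤ M) (x : Fin 3 → K) :
    x ∈ M ↔ Valued.v (x i) ≤ 1 ∧ x - Pi.single i (x i) ∈ M := by
  obtain ⟨hcoord, hei⟩ := v_apply_le_one_and_single_mem_of_block hvσ i hHcol hHrow hhi hHdet hcol hb hc hann hunit hM hSM
  constructor
  · exact fun hx => ⟨hcoord x hx, (sub_single_apply_mem_of_map_le_of_block i hcol hb hc hann hunit hSM hx).1⟩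
  · rintro ⟨hxi, hw⟩
    have hsingle : Pi.single i (x i) ∈ M := by
      have : (Pi.single i (x i) : Fin 3 → K) = (⟨x i, (mem_integer_iff' _).2 hxi⟩ : 𝒪[K]) • (Pi.single i (1 : K) : Fin 3 → K) := by
        ext l
        change (Pi.single i (x i) : Fin 3 → K) l = x i * (Pi.single i (1 : K) : Fin 3 → K) l
        by_cases hl : l = i
        · subst hl; simp
        · simp [Pi.single_eq_of_ne hl]
      rw [this]; exact M.smul_mem _ hei
    have := M.add_mem hw hsingle
    rwa [sub_add_cancel] at this

/-! ## §4 The binary part is self-dual RELATIVE to the hyperplane `W_i` -/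

/-- **RELATIVE SELF-DUALITY OF THE BINARY PART**: under the hypotheses of §2, for `w` with `w_i = 0`:
`w ∈ M ↔ ∀ m ∈ M, m_i = 0 → |⟨m, w⟩_H| ≤ 1` — the lattice `M ∩ W_i` is its own dual inside `(W_i, H|_{W_i})`: the type-(2) ROOT REGION ≅ the `S|_{W_i}`-stable self-dual BINARY
lattices (A-p12 (g23)'s binary fixed-ball counts). [cite: Kottwitz1986, §3] [cite: BruhatTits1972, §10] [cite: Serre1980Trees, II.1.1] -/
theorem mem_iff_forall_pairing_le_one_of_block {σ : K →+* K} (hvσ : ∀ a, Valued.v (σ a) = Valued.v a) {ϖ : K} {H : Matrix (Fin 3) (Fin 3) K} (i : Fin 3)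
    (hHrow : ∀ l, l ≠ i → H i l = 0) (hHdet : IsUnit H.det)
    {S : Matrix (Fin 3) (Fin 3) K} (hcol : ∀ l, l ≠ i → S l i = 0)
    {b c : K} (hb : Valued.v b ≤ 1) (hc : Valued.v c ≤ 1)
    (hann : ∀ w : Fin 3 → K, w i = 0 → S *ᵥ (S *ᵥ w) + b • (S *ᵥ w) + c • w = 0)
    (hunit : Valued.v (S i i * S i i + b * S i i + c) = 1)
    {M : Submodule 𝒪[K] (Fin 3 → K)} (hM : IsSelfDualLattice σ ϖ H M)
    (hSM : M.map ((Matrix.toLin' S).restrictScalars 𝒪[K]) ≤ M) {w : Fin 3 → K} (hwi : w i = 0) :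
    w ∈ M ↔ ∀ m ∈ M, m i = 0 → Valued.v (pairing σ H m w) ≤ 1 := by
  have hMd : M ≤ dualLatt σ H M := le_dualLatt_of_isVertexLattice hvσ hM
  constructor
  · intro hw m hm _
    exact (mem_dualLatt σ _ M _).1 (hMd hw) m hm
  · intro hdual
    rw [← dualLatt_eq_self_of_isSelfDualLattice hvσ hHdet hM, mem_dualLatt]
    intro m hm
    -- split `m = m_i e_i + m′`, `m′ ∈ M ∩ W_i`; the `e_i`-part pairs to zero with `w`
    obtain ⟨hm', hm'i⟩ := sub_single_apply_mem_of_map_le_of_block i hcol hb hc hann hunit hSM hm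
    have hsplit : pairing σ H m w = pairing σ H (m - Pi.single i (m i)) w := by
      have e : m = (m - Pi.single i (m i)) + Pi.single i (m i) := (sub_add_cancel _ _).symm
      conv_lhs => rw [e]
      rw [LinearMap.map_add₂, pairing_single_left_of_block σ H i hHrow, hwi, mul_zero, add_zero]
    rw [hsplit]
    exact hdual _ hm' hm'i

end Literature.NumberTheory.Automorphic.UnitaryLatticeTree

end
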